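import Mathlib
import Summits.ValiantsHypothesis.ValiantsHypothesis.Theorems.GrenetZeonTwoDimCoefficientsSlotAccounting

/-!
# Crux `GrenetZeon.TwoDimCoefficients` (stmt-ValiantsHypothesis-8062) / rung `DualUnipotentThreeHalves` (stmt-24318):
# the TWO-PIVOT SLOT LEMMA for consecutive-level graded pencils (Theorem T7, kernel plan step 3)

Memo TWENTY-SECOND HAND (evidence on both items), §2 «slot structure» in pencil currency and §4 step 3.  Data at a point:
a level function `lvl : Fin m → ℕ`; a matrix `K` with the PIVOT-INSERTION property of the graded resolvent
(`K i j = Σ_{lvl c = q} K i c·K c j` for `lvl i ≤ q ≤ lvl j`, ✓ `GradedPathFactor.resolvent_apply_eq_sum_level`);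
a constant `k`-drop matrix `M⁰` (`M⁰ d v ≠ 0 ⇒ lvl d = lvl v + k`); and DIRECTIONS `Nʸ` (graded: `Nʸ a b ≠ 0 ⇒ lvl b = lvl a + 1`)
and `Mʸ` (`k`-drop).  The cross form of ✓ `hess0_transl_trace_pow_mul_eq_cross_of_graded` reads, slot by slot, the
`(ℓ+1, ℓ)` block of `K·(Mʸ + Nʸ·K·M⁰)·K`.  For two pivot levels `p⁻ ≤ ℓ − 1`, `ℓ + 2 ≤ p⁺` with `p⁺ ≤ p⁻ + k + 1`:

* `proj_mul_mul_proj_eq_pivot` — pivot insertion in projector form: `Π_A·K·Π_B = Π_A·K·Π_q·K·Π_B` when `A ≤ q ≤ B`;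
* `proj_mul_eq_of_support` / `mul_proj_eq_of_support` — support transport through level projectors;
* ★ `slot_decomposition` — `Π_{ℓ+1}·K·(Mʸ + Nʸ·K·M⁰)·K·Π_ℓ = A⁺·X₁ + X₂·B⁻ + X₃·R` with the `y`-INDEPENDENT factors
  `A⁺ = Π_{ℓ+1}·K·Π_{p⁺}`, `B⁻ = Π_{p⁻}·K·Π_ℓ`, `R = Π_{p⁺}·K·Π_{≥p⁺}·M⁰·Π_{>p⁻}·K·Π_ℓ` (the window-summed right factor);
* ★ `slotBlock_mem_colSpace_sup_rowSpace` — hence the `(ℓ+1, ℓ)` block lies in «columns in `U`» ⊔ «rows in `V`» with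
  `U` = column space of the `(ℓ+1, p⁺)` block of `K` (`dim ≤ ν⁺`) and `V` = row span of the `(p⁻, ℓ)` block of `K` ⊔ row span of
  the `(p⁺, ℓ)` block of `R` (`dim ≤ ν⁻ + ν⁺`), `ν± = #{lvl = p±}`;
* ★ `finrank_range_slot_le` — so any linear slot map of this shape has `dim range ≤ w_ℓ·ν⁺ + w_{ℓ+1}·(ν⁻ + ν⁺)`
  (✓ `finrank_le_of_le_colSpace_sup_rowSpace`).

Pure linear algebra over a field.  HONEST FRAMING: a brick (step 3 of 5; steps 4–5 = accounting and pivot choice are not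
here); the stub `DualUnipotentBound`, the 24318 decl and `VP ≠ VNP` remain open.  References: folklore linear algebra. -/

set_option linter.dupNamespace false
set_option autoImplicit false

namespace Summit.ValiantsHypothesis.ValiantsHypothesis.Theorems.GrenetZeonTwoDimCoefficients.GradedSlotFactors

open Module Matrix
open Summit.ValiantsHypothesis.ValiantsHypothesis.Theorems.GrenetZeonTwoDimCoefficients.SlotAccounting

variable {F : Type*} [Field F] {m : ℕ} (lvl : Fin m → ℕ)

/-! ### Level projectors -/

/-- Entries of a product `Π_A·X·Π_B` with level projectors. [folklore] -/
theorem proj_mul_mul_proj_apply (A B : ℕ → Prop) [DecidablePred A] [DecidablePred B]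
    (X : Matrix (Fin m) (Fin m) F) (i j : Fin m) :
    (Matrix.diagonal (fun i => if A (lvl i) then (1 : F) else 0) * X *
        Matrix.diagonal (fun j => if B (lvl j) then (1 : F) else 0)) i j =
      if A (lvl i) ∧ B (lvl j) then X i j else 0 := by
  rw [Matrix.mul_diagonal, Matrix.diagonal_mul]
  by_cases hA : A (lvl i) <;> by_cases hB : B (lvl j) <;> simp [hA, hB]

/-- Complementary level projectors sum to the identity. [folklore] -/
theorem proj_add_proj_not (A : ℕ → Prop) [DecidablePred A] :
    Matrix.diagonal (fun i : Fin m => if A (lvl i) then (1 : F) else 0) +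
      Matrix.diagonal (fun i => if ¬ A (lvl i) then (1 : F) else 0) = 1 := by
  rw [Matrix.diagonal_add, ← Matrix.diagonal_one]
  congr 1
  funext i
  by_cases h : A (lvl i) <;> simp [h]

/-- ★ Pivot insertion in projector form: if `K` has the pivot-insertion property at level `q` and `A ≤ q ≤ B`
levelwise, then `Π_A·K·Π_B = Π_A·K·Π_q·K·Π_B`. [folklore] -/
theorem proj_mul_mul_proj_eq_pivot (K : Matrix (Fin m) (Fin m) F) (q : ℕ)
    (hK : ∀ i j, lvl i ≤ q → q ≤ lvl j →
      K i j = ∑ c ∈ Finset.univ.filter (fun c => lvl c = q), K i c * K c j)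
    (A B : ℕ → Prop) [DecidablePred A] [DecidablePred B] (hA : ∀ u, A u → u ≤ q) (hB : ∀ v, B v → q ≤ v) :
    Matrix.diagonal (fun i => if A (lvl i) then (1 : F) else 0) * K *
        Matrix.diagonal (fun j => if B (lvl j) then (1 : F) else 0) =
      Matrix.diagonal (fun i => if A (lvl i) then (1 : F) else 0) * K *
        Matrix.diagonal (fun c => if lvl c = q then (1 : F) else 0) * K *
        Matrix.diagonal (fun j => if B (lvl j) then (1 : F) else 0) := by
  ext i j
  rw [proj_mul_mul_proj_apply lvl A B K i j, Matrix.mul_diagonal, Matrix.mul_apply]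
  simp_rw [proj_mul_mul_proj_apply lvl A (fun u => u = q) K i]
  by_cases hAi : A (lvl i)
  · by_cases hBj : B (lvl j)
    · rw [if_pos ⟨hAi, hBj⟩, if_pos hBj, mul_one, hK i j (hA _ hAi) (hB _ hBj), Finset.sum_filter]
      refine Finset.sum_congr rfl fun c _ => ?_
      by_cases hc : lvl c = q <;> simp [hAi, hc]
    · rw [if_neg (fun h => hBj h.2), if_neg hBj, mul_zero]
  · rw [if_neg (fun h => hAi h.1)]
    simp [hAi]

/-- Support transport (left): if `X d v ≠ 0 ⇒ Rel (lvl d) (lvl v)` and `A u ∧ Rel u v ⇒ B v`, then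
`Π_A·X = Π_A·X·Π_B`. [folklore] -/
theorem proj_mul_eq_of_support (X : Matrix (Fin m) (Fin m) F) (Rel : ℕ → ℕ → Prop)
    (hX : ∀ d v, X d v ≠ 0 → Rel (lvl d) (lvl v))
    (A B : ℕ → Prop) [DecidablePred A] [DecidablePred B] (hAB : ∀ u v, A u → Rel u v → B v) :
    Matrix.diagonal (fun i => if A (lvl i) then (1 : F) else 0) * X =
      Matrix.diagonal (fun i => if A (lvl i) then (1 : F) else 0) * X *
        Matrix.diagonal (fun j => if B (lvl j) then (1 : F) else 0) := by
  ext d v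
  rw [Matrix.mul_diagonal, Matrix.diagonal_mul]
  by_cases hA : A (lvl d)
  · by_cases hx : X d v = 0
    · simp [hx]
    · rw [if_pos hA, if_pos (hAB _ _ hA (hX d v hx)), mul_one]
  · simp [hA]

/-- Support transport (right): if `X d v ≠ 0 ⇒ Rel (lvl d) (lvl v)` and `B v ∧ Rel u v ⇒ A u`, then
`X·Π_B = Π_A·X·Π_B`. [folklore] -/
theorem mul_proj_eq_of_support (X : Matrix (Fin m) (Fin m) F) (Rel : ℕ → ℕ → Prop)
    (hX : ∀ d v, X d v ≠ 0 → Rel (lvl d) (lvl v))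
    (A B : ℕ → Prop) [DecidablePred A] [DecidablePred B] (hBA : ∀ u v, B v → Rel u v → A u) :
    X * Matrix.diagonal (fun j => if B (lvl j) then (1 : F) else 0) =
      Matrix.diagonal (fun i => if A (lvl i) then (1 : F) else 0) * X *
        Matrix.diagonal (fun j => if B (lvl j) then (1 : F) else 0) := by
  ext d v
  rw [Matrix.mul_diagonal, Matrix.mul_diagonal, Matrix.diagonal_mul]
  by_cases hB : B (lvl v)
  · by_cases hx : X d v = 0
    · simp [hx]
    · rw [if_pos hB, if_pos (hBA _ _ hB (hX d v hx)), one_mul]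
  · simp [hB]

/-! ### The two-pivot decomposition of a slot -/

/-- ★ **Slot decomposition.**  With `K` pivot-inserting at `p⁻` and `p⁺`, `Nʸ` graded, `Mʸ`, `M⁰` `k`-drop, and pivots
`p⁻ + 1 ≤ ℓ`, `ℓ + 2 ≤ p⁺ ≤ p⁻ + k + 1`:
`Π_{ℓ+1}·K·(Mʸ + Nʸ·K·M⁰)·K·Π_ℓ = A⁺·X₁ + X₂·B⁻ + X₃·R` for some `X₁ X₂ X₃`, where
`A⁺ = Π_{ℓ+1}·K·Π_{p⁺}`, `B⁻ = Π_{p⁻}·K·Π_ℓ`, `R = Π_{p⁺}·K·Π_{≥p⁺}·M⁰·Π_{>p⁻}·K·Π_ℓ` do not depend on `(Nʸ, Mʸ)`. [folklore] -/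
theorem slot_decomposition (K M0 Ny My : Matrix (Fin m) (Fin m) F) (k ℓ pm pp : ℕ)
    (hK : ∀ q, (q = pm ∨ q = pp) → ∀ i j, lvl i ≤ q → q ≤ lvl j →
      K i j = ∑ c ∈ Finset.univ.filter (fun c => lvl c = q), K i c * K c j)
    (hNy : ∀ a b, Ny a b ≠ 0 → lvl b = lvl a + 1)
    (hMy : ∀ d v, My d v ≠ 0 → lvl d = lvl v + k) (hM0 : ∀ d v, M0 d v ≠ 0 → lvl d = lvl v + k)
    (hpm : pm + 1 ≤ ℓ) (hpp : ℓ + 2 ≤ pp) (hpiv : pp ≤ pm + k + 1) :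
    ∃ X₁ X₂ X₃ : Matrix (Fin m) (Fin m) F,
      Matrix.diagonal (fun i => if lvl i = ℓ + 1 then (1 : F) else 0) * K * (My + Ny * K * M0) * K *
          Matrix.diagonal (fun j => if lvl j = ℓ then (1 : F) else 0) =
        Matrix.diagonal (fun i => if lvl i = ℓ + 1 then (1 : F) else 0) * K *
            Matrix.diagonal (fun c => if lvl c = pp then (1 : F) else 0) * X₁ +
          X₂ * (Matrix.diagonal (fun c => if lvl c = pm then (1 : F) else 0) * K *
            Matrix.diagonal (fun j => if lvl j = ℓ then (1 : F) else 0)) +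
          X₃ * (Matrix.diagonal (fun c => if lvl c = pp then (1 : F) else 0) * K *
            Matrix.diagonal (fun d => if pp ≤ lvl d then (1 : F) else 0) * M0 *
            Matrix.diagonal (fun v => if pm < lvl v then (1 : F) else 0) * K *
            Matrix.diagonal (fun j => if lvl j = ℓ then (1 : F) else 0)) := by
  -- notation for the projectors
  set Pl : Matrix (Fin m) (Fin m) F := Matrix.diagonal (fun j => if lvl j = ℓ then (1 : F) else 0) with hPl
  set Pl1 : Matrix (Fin m) (Fin m) F := Matrix.diagonal (fun i => if lvl i = ℓ + 1 then (1 : F) else 0) with hPl1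
  set Ppp : Matrix (Fin m) (Fin m) F := Matrix.diagonal (fun c => if lvl c = pp then (1 : F) else 0) with hPpp
  set Ppm : Matrix (Fin m) (Fin m) F := Matrix.diagonal (fun c => if lvl c = pm then (1 : F) else 0) with hPpm
  set Pge : Matrix (Fin m) (Fin m) F := Matrix.diagonal (fun d => if pp ≤ lvl d then (1 : F) else 0) with hPge
  set Plt : Matrix (Fin m) (Fin m) F := Matrix.diagonal (fun d => if ¬ pp ≤ lvl d then (1 : F) else 0) with hPlt
  set Pgt : Matrix (Fin m) (Fin m) F := Matrix.diagonal (fun v => if pm < lvl v then (1 : F) else 0) with hPgt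
  set Ple : Matrix (Fin m) (Fin m) F := Matrix.diagonal (fun v => if ¬ pm < lvl v then (1 : F) else 0) with hPle
  set Plepp : Matrix (Fin m) (Fin m) F := Matrix.diagonal (fun v => if lvl v ≤ pp then (1 : F) else 0) with hPlepp
  -- (1) complements
  have hc1 : Pge + Plt = 1 := proj_add_proj_not lvl (fun u => pp ≤ u)
  have hc2 : Pgt + Ple = 1 := proj_add_proj_not lvl (fun u => pm < u)
  -- (2) pivot insertions
  have ha : Pl1 * K * Pge = Pl1 * K * Ppp * K * Pge :=
    proj_mul_mul_proj_eq_pivot lvl K pp (hK pp (Or.inr rfl)) (fun u => u = ℓ + 1) (fun u => pp ≤ u)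
      (fun u hu => by omega) (fun v hv => hv)
  have hb : Ple * K * Pl = Ple * K * Ppm * K * Pl :=
    proj_mul_mul_proj_eq_pivot lvl K pm (hK pm (Or.inl rfl)) (fun u => ¬ pm < u) (fun u => u = ℓ)
      (fun u hu => by omega) (fun v hv => by omega)
  have hc : Plepp * K * Pge = Plepp * K * Ppp * K * Pge :=
    proj_mul_mul_proj_eq_pivot lvl K pp (hK pp (Or.inr rfl)) (fun u => u ≤ pp) (fun u => pp ≤ u)
      (fun u hu => hu) (fun v hv => hv)
  -- (3) support transports
  have hs1 : Plt * My = Plt * My * Ple :=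
    proj_mul_eq_of_support lvl My (fun u v => u = v + k) hMy (fun u => ¬ pp ≤ u) (fun v => ¬ pm < v)
      (fun u v hu huv => by omega)
  have hs2 : Plt * Ny = Plt * Ny * Plepp :=
    proj_mul_eq_of_support lvl Ny (fun u v => v = u + 1) (fun a b h => hNy a b h) (fun u => ¬ pp ≤ u)
      (fun v => v ≤ pp) (fun u v hu huv => by omega)
  have hs3 : M0 * Pgt = Pge * M0 * Pgt :=
    mul_proj_eq_of_support lvl M0 (fun u v => u = v + k) hM0 (fun u => pp ≤ u) (fun v => pm < v)
      (fun u v hv huv => by omega)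
  refine ⟨K * Pge * (My + Ny * K * M0) * K * Pl,
    Pl1 * K * Plt * (My + Ny * K * M0) * Ple * K,
    Pl1 * K * Plt * Ny * Plepp * K, ?_⟩
  -- split the first `K·W` at `p⁺`
  have step1 : Pl1 * K * (My + Ny * K * M0) * K * Pl =
      Pl1 * K * Pge * (My + Ny * K * M0) * K * Pl + Pl1 * K * Plt * (My + Ny * K * M0) * K * Pl := by
    have e : Pl1 * K * (My + Ny * K * M0) = Pl1 * K * (Pge + Plt) * (My + Ny * K * M0) := by
      rw [hc1, Matrix.mul_one]
    rw [e]
    simp only [Matrix.mul_add, Matrix.add_mul]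
    abel
  -- the `≥ p⁺` part factors through `A⁺` on the left
  have part1 : Pl1 * K * Pge * (My + Ny * K * M0) * K * Pl =
      Pl1 * K * Ppp * (K * Pge * (My + Ny * K * M0) * K * Pl) := by
    rw [ha]
    simp only [Matrix.mul_assoc]
  -- the `< p⁺` part: split the last `K` at `p⁻`
  have part2 : Pl1 * K * Plt * (My + Ny * K * M0) * K * Pl =
      Pl1 * K * Plt * (My + Ny * K * M0) * Ple * K * Pl + Pl1 * K * Plt * Ny * K * M0 * Pgt * K * Pl := by
    have eMy : Pl1 * K * Plt * My * K * Pl = Pl1 * K * Plt * My * Ple * K * Pl := by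
      have : Pl1 * K * Plt * My = Pl1 * K * (Plt * My) := by simp only [Matrix.mul_assoc]
      conv_lhs => rw [this, hs1]
      simp only [Matrix.mul_assoc]
    have eNy : Pl1 * K * Plt * (Ny * K * M0) * K * Pl =
        Pl1 * K * Plt * (Ny * K * M0) * Ple * K * Pl + Pl1 * K * Plt * Ny * K * M0 * Pgt * K * Pl := by
      have : Pl1 * K * Plt * (Ny * K * M0) * K * Pl = Pl1 * K * Plt * (Ny * K * M0) * (Pgt + Ple) * K * Pl := by
        rw [hc2, Matrix.mul_one]
      rw [this]
      simp only [Matrix.mul_add, Matrix.add_mul, Matrix.mul_assoc]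
      rw [add_comm]
    rw [show Pl1 * K * Plt * (My + Ny * K * M0) * K * Pl =
        Pl1 * K * Plt * My * K * Pl + Pl1 * K * Plt * (Ny * K * M0) * K * Pl by
      simp only [Matrix.mul_add, Matrix.add_mul]]
    rw [eMy, eNy]
    simp only [Matrix.mul_add, Matrix.add_mul]
    abel
  -- the `≤ p⁻` sub-part factors through `B⁻` on the right
  have part2a : Pl1 * K * Plt * (My + Ny * K * M0) * Ple * K * Pl =
      Pl1 * K * Plt * (My + Ny * K * M0) * Ple * K * (Ppm * K * Pl) := by
    have : Pl1 * K * Plt * (My + Ny * K * M0) * Ple * K * Pl =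
        Pl1 * K * Plt * (My + Ny * K * M0) * (Ple * K * Pl) := by simp only [Matrix.mul_assoc]
    rw [this, hb]
    simp only [Matrix.mul_assoc]
  -- the `> p⁻` sub-part factors through `R` on the right
  have part2b : Pl1 * K * Plt * Ny * K * M0 * Pgt * K * Pl =
      Pl1 * K * Plt * Ny * Plepp * K * (Ppp * K * Pge * M0 * Pgt * K * Pl) := by
    have e1 : Pl1 * K * Plt * Ny * K * M0 * Pgt * K * Pl = Pl1 * K * (Plt * Ny) * K * (M0 * Pgt) * K * Pl := by
      simp only [Matrix.mul_assoc]
    rw [e1, hs2, hs3]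
    have e2 : Pl1 * K * (Plt * Ny * Plepp) * K * (Pge * M0 * Pgt) * K * Pl =
        Pl1 * K * Plt * Ny * (Plepp * K * Pge) * M0 * Pgt * K * Pl := by
      simp only [Matrix.mul_assoc]
    rw [e2, hc]
    simp only [Matrix.mul_assoc]
  rw [step1, part1, part2, part2a, part2b]
  simp only [Matrix.mul_assoc]
  abel

/-! ### The block and its membership in «columns in `U`» ⊔ «rows in `V`» -/

/-- The `(a, ·)` block of `Π_a·Y` is the `(a, ·)` block of `Y`. [folklore] -/
theorem submatrix_proj_mul (a : ℕ) (Y : Matrix (Fin m) (Fin m) F) {β : Type*} (g : β → Fin m) :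
    (Matrix.diagonal (fun i => if lvl i = a then (1 : F) else 0) * Y).submatrix
        (Subtype.val : {i : Fin m // lvl i = a} → Fin m) g = Y.submatrix Subtype.val g := by
  ext i j
  simp [Matrix.submatrix_apply, Matrix.diagonal_mul, i.2]

/-- The `(·, b)` block of `Y·Π_b` is the `(·, b)` block of `Y`. [folklore] -/
theorem submatrix_mul_proj (b : ℕ) (Y : Matrix (Fin m) (Fin m) F) {α : Type*} (f : α → Fin m) :
    (Y * Matrix.diagonal (fun j => if lvl j = b then (1 : F) else 0)).submatrix f
        (Subtype.val : {j : Fin m // lvl j = b} → Fin m) = Y.submatrix f Subtype.val := by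
  ext i j
  simp [Matrix.submatrix_apply, Matrix.mul_diagonal, j.2]

/-- The level-`a` rows of `Y·Π_{=q}·Z` factor through the `(a, q)` block of `Y`:
`(Y·Π_q·Z)|_{a × β} = Y|_{a × q} · Z|_{q × β}`. [folklore] -/
theorem submatrix_mul_proj_mul (q : ℕ) (Y Z : Matrix (Fin m) (Fin m) F) {α β : Type*} (f : α → Fin m)
    (g : β → Fin m) :
    (Y * Matrix.diagonal (fun c => if lvl c = q then (1 : F) else 0) * Z).submatrix f g =
      Y.submatrix f (Subtype.val : {c : Fin m // lvl c = q} → Fin m) *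
        Z.submatrix (Subtype.val : {c : Fin m // lvl c = q} → Fin m) g := by
  classical
  ext i j
  rw [Matrix.submatrix_apply, Matrix.mul_apply, Matrix.mul_apply]
  have h1 : ∀ c, (Y * Matrix.diagonal (fun c => if lvl c = q then (1 : F) else 0)) (f i) c * Z c (g j) =
      if lvl c = q then Y (f i) c * Z c (g j) else 0 := by
    intro c
    rw [Matrix.mul_diagonal]
    split_ifs <;> simp
  simp_rw [h1]
  rw [← Finset.sum_filter,
    Finset.sum_subtype (Finset.univ.filter (fun c : Fin m => lvl c = q)) (p := fun c => lvl c = q) (by simp)]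
  rfl

/-- ★ **Block membership.**  Under the hypotheses of `slot_decomposition`, the `(ℓ+1, ℓ)` block of
`K·(Mʸ + Nʸ·K·M⁰)·K` lies in «columns in `U`» ⊔ «rows in `V`», `U` = column space of the `(ℓ+1, p⁺)` block of `K`,
`V` = row span of the `(p⁻, ℓ)` block of `K` ⊔ row span of the `(p⁺, ℓ)` block of `K·Π_{≥p⁺}·M⁰·Π_{>p⁻}·K` —
all independent of the direction `(Nʸ, Mʸ)`. [folklore] -/
theorem slotBlock_mem_colSpace_sup_rowSpace (K M0 Ny My : Matrix (Fin m) (Fin m) F) (k ℓ pm pp : ℕ)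
    (hK : ∀ q, (q = pm ∨ q = pp) → ∀ i j, lvl i ≤ q → q ≤ lvl j →
      K i j = ∑ c ∈ Finset.univ.filter (fun c => lvl c = q), K i c * K c j)
    (hNy : ∀ a b, Ny a b ≠ 0 → lvl b = lvl a + 1)
    (hMy : ∀ d v, My d v ≠ 0 → lvl d = lvl v + k) (hM0 : ∀ d v, M0 d v ≠ 0 → lvl d = lvl v + k)
    (hpm : pm + 1 ≤ ℓ) (hpp : ℓ + 2 ≤ pp) (hpiv : pp ≤ pm + k + 1) :
    (K * (My + Ny * K * M0) * K).submatrix (Subtype.val : {i : Fin m // lvl i = ℓ + 1} → Fin m)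
        (Subtype.val : {j : Fin m // lvl j = ℓ} → Fin m) ∈
      (((Submodule.pi Set.univ (fun _ : {j : Fin m // lvl j = ℓ} =>
            LinearMap.range (K.submatrix (Subtype.val : {i : Fin m // lvl i = ℓ + 1} → Fin m)
              (Subtype.val : {c : Fin m // lvl c = pp} → Fin m)).mulVecLin)).map
          (Matrix.ofLinearEquiv F : ({j : Fin m // lvl j = ℓ} → {i : Fin m // lvl i = ℓ + 1} → F) ≃ₗ[F]
            Matrix {j : Fin m // lvl j = ℓ} {i : Fin m // lvl i = ℓ + 1} F).toLinearMap).map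
          (Matrix.transposeLinearEquiv {j : Fin m // lvl j = ℓ} {i : Fin m // lvl i = ℓ + 1} F F).toLinearMap) ⊔
        ((Submodule.pi Set.univ (fun _ : {i : Fin m // lvl i = ℓ + 1} =>
            Submodule.span F (Set.range fun c : {c : Fin m // lvl c = pm} =>
                K.submatrix (Subtype.val : {c : Fin m // lvl c = pm} → Fin m)
                  (Subtype.val : {j : Fin m // lvl j = ℓ} → Fin m) c) ⊔
              Submodule.span F (Set.range fun c : {c : Fin m // lvl c = pp} =>
                (K * Matrix.diagonal (fun d => if pp ≤ lvl d then (1 : F) else 0) * M0 *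
                    Matrix.diagonal (fun v => if pm < lvl v then (1 : F) else 0) * K).submatrix
                  (Subtype.val : {c : Fin m // lvl c = pp} → Fin m)
                  (Subtype.val : {j : Fin m // lvl j = ℓ} → Fin m) c))).map
          (Matrix.ofLinearEquiv F : ({i : Fin m // lvl i = ℓ + 1} → {j : Fin m // lvl j = ℓ} → F) ≃ₗ[F]
            Matrix {i : Fin m // lvl i = ℓ + 1} {j : Fin m // lvl j = ℓ} F).toLinearMap) := by
  classical
  obtain ⟨X₁, X₂, X₃, hdec⟩ := slot_decomposition lvl K M0 Ny My k ℓ pm pp hK hNy hMy hM0 hpm hpp hpiv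
  set Pl : Matrix (Fin m) (Fin m) F := Matrix.diagonal (fun j => if lvl j = ℓ then (1 : F) else 0) with hPl
  set Pl1 : Matrix (Fin m) (Fin m) F := Matrix.diagonal (fun i => if lvl i = ℓ + 1 then (1 : F) else 0) with hPl1
  set Ppp : Matrix (Fin m) (Fin m) F := Matrix.diagonal (fun c => if lvl c = pp then (1 : F) else 0) with hPpp
  set Ppm : Matrix (Fin m) (Fin m) F := Matrix.diagonal (fun c => if lvl c = pm then (1 : F) else 0) with hPpm
  set Pge : Matrix (Fin m) (Fin m) F := Matrix.diagonal (fun d => if pp ≤ lvl d then (1 : F) else 0)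
  set Pgt : Matrix (Fin m) (Fin m) F := Matrix.diagonal (fun v => if pm < lvl v then (1 : F) else 0)
  set W := My + Ny * K * M0
  -- put the projectors around the block
  have e0 : (K * W * K).submatrix (Subtype.val : {i : Fin m // lvl i = ℓ + 1} → Fin m)
        (Subtype.val : {j : Fin m // lvl j = ℓ} → Fin m) =
      (Pl1 * K * W * K * Pl).submatrix Subtype.val Subtype.val := by
    rw [hPl, submatrix_mul_proj lvl ℓ, show Pl1 * K * W * K = Pl1 * (K * W * K) by
      simp only [Matrix.mul_assoc], hPl1, submatrix_proj_mul lvl (ℓ + 1)]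
  rw [e0, hdec]
  simp only [Matrix.submatrix_add, Pi.add_apply]
  -- the three blocks
  have t1 : (Pl1 * K * Ppp * X₁).submatrix (Subtype.val : {i : Fin m // lvl i = ℓ + 1} → Fin m)
        (Subtype.val : {j : Fin m // lvl j = ℓ} → Fin m) =
      K.submatrix (Subtype.val : {i : Fin m // lvl i = ℓ + 1} → Fin m)
          (Subtype.val : {c : Fin m // lvl c = pp} → Fin m) *
        X₁.submatrix (Subtype.val : {c : Fin m // lvl c = pp} → Fin m)
          (Subtype.val : {j : Fin m // lvl j = ℓ} → Fin m) *
        (1 : Matrix {j : Fin m // lvl j = ℓ} {j : Fin m // lvl j = ℓ} F) := by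
    rw [Matrix.mul_one, hPpp, submatrix_mul_proj_mul lvl pp, hPl1, submatrix_proj_mul lvl (ℓ + 1)]
  have t2 : (X₂ * (Ppm * K * Pl)).submatrix (Subtype.val : {i : Fin m // lvl i = ℓ + 1} → Fin m)
        (Subtype.val : {j : Fin m // lvl j = ℓ} → Fin m) =
      (1 : Matrix {i : Fin m // lvl i = ℓ + 1} {i : Fin m // lvl i = ℓ + 1} F) *
        X₂.submatrix (Subtype.val : {i : Fin m // lvl i = ℓ + 1} → Fin m)
          (Subtype.val : {c : Fin m // lvl c = pm} → Fin m) *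
        K.submatrix (Subtype.val : {c : Fin m // lvl c = pm} → Fin m)
          (Subtype.val : {j : Fin m // lvl j = ℓ} → Fin m) := by
    rw [Matrix.one_mul, show X₂ * (Ppm * K * Pl) = X₂ * Ppm * (K * Pl) by simp only [Matrix.mul_assoc], hPpm,
      submatrix_mul_proj_mul lvl pm, hPl, submatrix_mul_proj lvl ℓ]
  have t3 : (X₃ * (Ppp * K * Pge * M0 * Pgt * K * Pl)).submatrix (Subtype.val : {i : Fin m // lvl i = ℓ + 1} → Fin m)
        (Subtype.val : {j : Fin m // lvl j = ℓ} → Fin m) =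
      (1 : Matrix {i : Fin m // lvl i = ℓ + 1} {i : Fin m // lvl i = ℓ + 1} F) *
        X₃.submatrix (Subtype.val : {i : Fin m // lvl i = ℓ + 1} → Fin m)
          (Subtype.val : {c : Fin m // lvl c = pp} → Fin m) *
        (K * Pge * M0 * Pgt * K).submatrix (Subtype.val : {c : Fin m // lvl c = pp} → Fin m)
          (Subtype.val : {j : Fin m // lvl j = ℓ} → Fin m) := by
    rw [Matrix.one_mul, show X₃ * (Ppp * K * Pge * M0 * Pgt * K * Pl) = X₃ * Ppp * (K * Pge * M0 * Pgt * K * Pl) by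
      simp only [Matrix.mul_assoc], hPpp, submatrix_mul_proj_mul lvl pp, hPl, submatrix_mul_proj lvl ℓ]
  rw [t1, t2, t3]
  refine Submodule.add_mem _ (Submodule.add_mem _ ?_ ?_) ?_
  · refine Submodule.mem_sup_left (mul_mul_mem_colSpace _ _ _ _ fun c => ?_)
    have h := col_mul_mem_range_mulVecLin
      (K.submatrix (Subtype.val : {i : Fin m // lvl i = ℓ + 1} → Fin m)
        (Subtype.val : {c : Fin m // lvl c = pp} → Fin m))
      (1 : Matrix {c : Fin m // lvl c = pp} {c : Fin m // lvl c = pp} F) c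
    rwa [Matrix.mul_one] at h
  · refine Submodule.mem_sup_right (mul_mul_mem_rowSpace _ _ _ _ fun c => ?_)
    exact Submodule.mem_sup_left (Submodule.subset_span ⟨c, rfl⟩)
  · refine Submodule.mem_sup_right (mul_mul_mem_rowSpace _ _ _ _ fun c => ?_)
    exact Submodule.mem_sup_right (Submodule.subset_span ⟨c, rfl⟩)

/-- ★ **The two-pivot slot rate.**  A linear slot map `C` all of whose values are `(ℓ+1, ℓ)` blocks of
`K·(Mʸ + Nʸ·K·M⁰)·K` for directions `Nʸ` (graded), `Mʸ` (`k`-drop), with `K`, `M⁰` and the pivots as in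
`slot_decomposition`, has `dim range C ≤ w_ℓ·ν⁺ + w_{ℓ+1}·(ν⁻ + ν⁺)`, where `w_q = ν_q = #{i : lvl i = q}`. [folklore] -/
theorem finrank_range_slot_le (K M0 : Matrix (Fin m) (Fin m) F) (k ℓ pm pp : ℕ)
    (hK : ∀ q, (q = pm ∨ q = pp) → ∀ i j, lvl i ≤ q → q ≤ lvl j →
      K i j = ∑ c ∈ Finset.univ.filter (fun c => lvl c = q), K i c * K c j)
    (hM0 : ∀ d v, M0 d v ≠ 0 → lvl d = lvl v + k)
    (hpm : pm + 1 ≤ ℓ) (hpp : ℓ + 2 ≤ pp) (hpiv : pp ≤ pm + k + 1)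
    {Y : Type*} [AddCommGroup Y] [Module F Y]
    (C : Y →ₗ[F] Matrix {i : Fin m // lvl i = ℓ + 1} {j : Fin m // lvl j = ℓ} F)
    (hC : ∀ y, ∃ Ny My : Matrix (Fin m) (Fin m) F, (∀ a b, Ny a b ≠ 0 → lvl b = lvl a + 1) ∧
      (∀ d v, My d v ≠ 0 → lvl d = lvl v + k) ∧
      C y = (K * (My + Ny * K * M0) * K).submatrix Subtype.val Subtype.val) :
    finrank F ↥(LinearMap.range C) ≤
      Fintype.card {j : Fin m // lvl j = ℓ} * Fintype.card {c : Fin m // lvl c = pp} +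
        Fintype.card {i : Fin m // lvl i = ℓ + 1} *
          (Fintype.card {c : Fin m // lvl c = pm} + Fintype.card {c : Fin m // lvl c = pp}) := by
  classical
  have h := finrank_le_of_le_colSpace_sup_rowSpace
    (LinearMap.range (K.submatrix (Subtype.val : {i : Fin m // lvl i = ℓ + 1} → Fin m)
      (Subtype.val : {c : Fin m // lvl c = pp} → Fin m)).mulVecLin)
    (Submodule.span F (Set.range fun c : {c : Fin m // lvl c = pm} =>
        K.submatrix (Subtype.val : {c : Fin m // lvl c = pm} → Fin m)
          (Subtype.val : {j : Fin m // lvl j = ℓ} → Fin m) c) ⊔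
      Submodule.span F (Set.range fun c : {c : Fin m // lvl c = pp} =>
        (K * Matrix.diagonal (fun d => if pp ≤ lvl d then (1 : F) else 0) * M0 *
            Matrix.diagonal (fun v => if pm < lvl v then (1 : F) else 0) * K).submatrix
          (Subtype.val : {c : Fin m // lvl c = pp} → Fin m)
          (Subtype.val : {j : Fin m // lvl j = ℓ} → Fin m) c))
    (LinearMap.range C) (by
      rintro _ ⟨y, rfl⟩
      obtain ⟨Ny, My, hNy, hMy, hy⟩ := hC y
      rw [hy]
      exact slotBlock_mem_colSpace_sup_rowSpace lvl K M0 Ny My k ℓ pm pp hK hNy hMy hM0 hpm hpp hpiv)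
  have hU := finrank_range_mulVecLin_le_card
    (K.submatrix (Subtype.val : {i : Fin m // lvl i = ℓ + 1} → Fin m)
      (Subtype.val : {c : Fin m // lvl c = pp} → Fin m))
  have hV1 := finrank_span_rows_le_card
    (K.submatrix (Subtype.val : {c : Fin m // lvl c = pm} → Fin m)
      (Subtype.val : {j : Fin m // lvl j = ℓ} → Fin m))
  have hV2 := finrank_span_rows_le_card
    ((K * Matrix.diagonal (fun d => if pp ≤ lvl d then (1 : F) else 0) * M0 *
        Matrix.diagonal (fun v => if pm < lvl v then (1 : F) else 0) * K).submatrix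
      (Subtype.val : {c : Fin m // lvl c = pp} → Fin m)
      (Subtype.val : {j : Fin m // lvl j = ℓ} → Fin m))
  have hV := (Submodule.finrank_add_le_finrank_add_finrank _ _).trans (Nat.add_le_add hV1 hV2)
  refine h.trans ((Nat.sub_le _ _).trans ?_)
  exact Nat.add_le_add (Nat.mul_le_mul_left _ hU) (Nat.mul_le_mul_left _ hV)

end Summit.ValiantsHypothesis.ValiantsHypothesis.Theorems.GrenetZeonTwoDimCoefficients.GradedSlotFactors
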